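import Literature.Computability.Cryptography.RegevSamplerEraseGates
import Literature.Computability.QuantumComplexity.CoreDescBlockFP
import Literature.Computability.Complexity.CodeFPLists
import HarnessLib

/-!
# The erase layer of the data-free machine on codes (Regev 2009, Lemma 3.14: uniformity, stage S1)

Topic `Literature/Computability/Cryptography`; gen-11 module M3/S1 of the sampler route for
`regev2009_lemma_3_14_stepFamily`. The machine circuit `machineCircPar` (`RegevSamplerMachinePar.lean`) ends
in the ERASE layer `cnotLayer (GRData.parSrc E src) (GRData.parList E)`: one `CNOT` from the source wire
`srcU I Λ p₀ t` of the input zone onto the parameter wire `E i (pw t)` of block `i`, for every `i < n` and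
`t < np` (`RegevSamplerEraseGates.cnotLayer_par_gates`). Following the tree's uniformity pipeline for the AJL
core (`CoreDescAbstract.lean` … `CoreDescUniform.lean`: Arora–Barak, §6.2, proof of Thm. 6.15 — replace the
dependently typed gates by ABSTRACT gates `AJLCore.AG` with `ℕ`-valued wires, `QCircuit.encode = rawE agE ∘ map toAG`
(`AJLCore.encode_eq_rawE`), and compute the abstract list in the typed `FP` algebra `CodeFP`) we prove:

* `eraseA n np src0 base B ℓ` — the abstract erase layer: for `i < n`, `t < np`, `CNOT (src0 + t) (base + (i·B + (ℓ + t)))`;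
* **`map_toAG_cnotLayer_par`** — for a layout with `loc = id` (the standard / schedule layouts) the erase layer of
  the standard data-free machine abstracts to `eraseA n np (n·ℓ + p₀) Λ.base B Λ.ℓ` (from `cnotLayer_par_gates`,
  `val_srcU`, `val_stdEmb_pw`);
* **`eraseA_fp`** — `(1^cap, (n, np, src0, base, B, ℓ)) ↦ eraseA (min n cap) (min np cap) src0 base B ℓ` is computed in
  polynomial time on codes (`CodeFP (pairE unE epE) (rawE agE0)`; the unary cap bounds the two loop ranges,
  `CodeFP.rangeOf`; in the uniformity proof `cap` is the input length and `n, np ≤ cap`).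

So stage S1 of the description of the inner uniform family is discharged up to the size decoder (which supplies
the six numbers from the length code). No named fact is introduced.

HONEST FRAMING: the VALUE is a THEOREM (kernel-checked lemmas of a KNOWN reduction, Regev 2009) — NOT summit
progress; the trust base `{A_q14}` of `pqc.S19` is unchanged by this file.

## References

* O. Regev, *On lattices, learning with errors, random linear codes, and cryptography*, J. ACM 56(6) (2009),
  Art. 34 — Lemma 3.14 (proof: the registers are uncomputed; the circuit is uniform) [Regev2009].
* S. Arora, B. Barak, *Computational Complexity: A Modern Approach*, CUP 2009, §6.2 and proof of Thm. 6.15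
  (descriptions printed gate by gate with counters) [AroraBarak2009].
* M. A. Nielsen, I. L. Chuang, *Quantum Computation and Quantum Information*, CUP 2010, §3.2.5, §4.3
  [NielsenChuang2010].
-/

noncomputable section

namespace Literature.Computability.Cryptography.Regev2009.SamplerRegs

open _root_.Computability Literature.Algebra.EuclideanLattices Literature.Algebra.EuclideanLattices.Regev2009
  Literature.Computability.QuantumComplexity Literature.Computability.QuantumComplexity.AJLCore
  Literature.Computability.Complexity Literature.Computability.Complexity.CodeFP SamplerClassical SamplerClassical.Layout

/-! ### The abstract erase layer -/

/-- **The abstract erase layer**: for `i < n` and `t < np`, the gate `CNOT (src0 + t) (base + (i·B + (ℓ + t)))`, blocks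
outer, parameter bits inner. [cite: Regev2009, Lemma 3.14 (proof: uncomputation)] [cite: AroraBarak2009, §6.2] -/
def eraseA (n np src0 base B ℓ : ℕ) : List AG :=
  (List.range n).flatMap fun i => (List.range np).map fun t => ⟨.CNOT, [src0 + t, base + (i * B + (ℓ + t))]⟩

/-- The length of the abstract erase layer. [folklore] -/
theorem length_eraseA (n np src0 base B ℓ : ℕ) : (eraseA n np src0 base B ℓ).length = n * np := by
  rw [eraseA, List.length_flatMap]
  simp [List.map_const', List.sum_replicate]

section Std

variable {W : ℕ} (I : LatticeInstance) {Λ : Layout W I.n} (hΛ : Λ.OK)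

/-- **The erase layer of the standard data-free machine abstracts to `eraseA`** (layouts with `loc = id`, e.g. the
standard and schedule layouts). [cite: Regev2009, Lemma 3.14 (proof: uncomputation)] [cite: AroraBarak2009, §6.2] -/
theorem map_toAG_cnotLayer_par {np wlen kk : ℕ} (hWE : Λ.base + I.n * GRData.B Λ.ℓ np wlen kk ≤ W) {p₀ : ℕ}
    (hp : p₀ + np ≤ Λ.L) (hE : BlockDisjoint (stdEmb I hΛ hWE)) (hloc : ∀ s, Λ.loc s = s) :
    (cnotLayer (GRData.parSrc (stdEmb I hΛ hWE) (srcU I Λ p₀)) (GRData.parList (stdEmb I hΛ hWE))).gates.map toAG =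
      eraseA I.n np (I.n * Λ.ℓ + p₀) Λ.base (GRData.B Λ.ℓ np wlen kk) Λ.ℓ := by
  rw [cnotLayer_par_gates I hΛ hWE hp hE, List.map_flatMap, eraseA]
  simp only [← List.map_coe_finRange_eq_range, List.flatMap_map, List.map_map]
  congr 1
  funext i
  congr 1
  funext t
  simp only [Function.comp_apply, eraseGate, toAG_cnotOn, val_srcU I hΛ hp, val_stdEmb_pw I hΛ hWE, hloc, Nat.add_assoc]

end Std

/-! ### The abstract erase layer on codes -/

/-- The erase parameters `(n, np, src0, base, B, ℓ)`. [folklore] -/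
abbrev EraseParams : Type := ℕ × ℕ × ℕ × ℕ × ℕ × ℕ

/-- Their code: six binary numerals. [folklore] -/
abbrev epE : EraseParams → List Bool := pairE natE (pairE natE (pairE natE (pairE natE (pairE natE natE))))

/-- **The abstract erase layer is computed in polynomial time on codes** (ranges capped by the unary first component).
[cite: AroraBarak2009, §6.2 and proof of Thm. 6.15] -/
theorem eraseA_fp : CodeFP (pairE unE epE) (rawE agE0)
    (fun p => eraseA (min p.2.1 p.1) (min p.2.2.1 p.1) p.2.2.2.1 p.2.2.2.2.1 p.2.2.2.2.2.1 p.2.2.2.2.2.2) := by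
  -- contexts: `d = (cap, σ)`, `c = (d, i)`, `q = (c, t)`
  have hgate : CodeFP (pairE (pairE (pairE unE epE) natE) natE) agE0
      (fun q => (⟨.CNOT, [q.1.1.2.2.2.1 + q.2, q.1.1.2.2.2.2.1 + (q.1.2 * q.1.1.2.2.2.2.2.1 + (q.1.1.2.2.2.2.2.2 + q.2))]⟩ : AG)) := by
    have hσ : CodeFP (pairE (pairE (pairE unE epE) natE) natE) epE (fun q => q.1.1.2) := (fst _ _).fst'.snd'
    have ht : CodeFP (pairE (pairE (pairE unE epE) natE) natE) natE (fun q => q.2) := snd _ _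
    have hi : CodeFP (pairE (pairE (pairE unE epE) natE) natE) natE (fun q => q.1.2) := (fst _ _).snd'
    refine ag_CX (natAdd.comp (hσ.snd'.snd'.fst'.pair ht) :) ?_
    exact (natAdd.comp (hσ.snd'.snd'.snd'.fst'.pair (natAdd.comp ((natMul.comp (hi.pair hσ.snd'.snd'.snd'.snd'.fst')).pair
      (natAdd.comp (hσ.snd'.snd'.snd'.snd'.snd'.pair ht))))) :)
  have hinner : CodeFP (pairE (pairE unE epE) natE) (rawE agE0)
      (fun c => (List.range (min c.1.2.2.1 c.1.1)).map fun t =>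
        (⟨.CNOT, [c.1.2.2.2.1 + t, c.1.2.2.2.2.1 + (c.2 * c.1.2.2.2.2.2.1 + (c.1.2.2.2.2.2.2 + t))]⟩ : AG)) :=
    ((map hgate).comp ((CodeFP.id _).pair (rangeOf.comp ((fst _ _).fst'.pair (fst _ _).snd'.snd'.fst'))) :)
  have houter : CodeFP (pairE unE epE) (rawE (rawE agE0))
      (fun d => (List.range (min d.2.1 d.1)).map fun i => (List.range (min d.2.2.1 d.1)).map fun t =>
        (⟨.CNOT, [d.2.2.2.1 + t, d.2.2.2.2.1 + (i * d.2.2.2.2.2.1 + (d.2.2.2.2.2.2 + t))]⟩ : AG)) :=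
    ((map hinner).comp ((CodeFP.id _).pair (rangeOf.comp ((fst _ _).pair (snd _ _).fst'))) :)
  exact ((flatten agE0).comp houter).congr fun d => rfl

end Literature.Computability.Cryptography.Regev2009.SamplerRegs

end
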